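import Summits.QuantumFields.YangMills.Theorems.BalabanUVNodesN15CurvedGluingCubeSmoothCutDressed
import Summits.QuantumFields.YangMills.Theorems.BalabanUVNodesN15CurvedGluingCubeDressedGeneralRightEntries
import HarnessLib

/-!
# Route «BalabanUVNodes» (cluster K4 «SpineRates»), Track-A DAG node N15 = NE2, BACKGROUND LAYER — THE DRESSED SMOOTH-CUT CUBE's RIGHT ENTRIES BY NAME: file 29 run at `G₀ := M_{χ̃}N_□`, the flat
# right entries `G₀∘Q`, `∇^±G₀∘Q` read from the RIGHT cut rows `M_χ(N_□∘Q)`, `M_χ(∇^±N_□∘Q)` through file 31 at `N := N_□∘Q`: `X∘Q` two-sided for a nested-cut `Q`, and `X∘∇^±_ν` (FILE 58 `hGE`,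
# FILE 49 ∕ file 14 `hD`∕`hDb` at a live background)

Cell `pub-ymgap`, seat `pub-ymgap-dag-n15-w3` (WIDTH SEAT 3∕3 on node N15, director-ym №197 ∕ HUMAN RULING D-0149; plan `W-SEAT-START-LIST.md` §n15 item 3 «LG-vector + background layers at
GENERAL small-field U» — thirty-sixth piece).  `bears_on: R4∕N15 · K3⁷ SpineGivenEndpointR13SepCoPH (stmt-QuantumFields-20544)`.  Filed `--kind proof --supports stmt-QuantumFields-20544 --as
helper` — COUNT-NEUTRAL.  Theorems only; 0 `sorry`.  Imports BY NAME file 34 `…CurvedGluingCubeSmoothCutDressed` (`hasMaj_smoothCut_flat`, `hasMaj_jet_smoothCut_flat`; file 31 `smoothCut_out`,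
`smoothCut_in`) and file 29 `…CubeDressedGeneralRightEntries` (`hasMaj_projO_dressedV_comp_loc₂`, `hasMaj_dressedV_comp_fgrad_loc₂`, `hasMaj_dressedV_comp_bgrad_loc₂`); nothing in the tree is modified.

WHY.  FILE 58's entry 2 (`hGE`) and the adjoint remainder rows (n15-w5 `…CommutatorAdjoint`, FILE 49) read the cube through RIGHT entries `X∘E`, `X∘∇^±_ν`.  File 29 derives them for the
general dressed cube from the flat right entries `G₀∘Q`, `D_j∘Q`; at `G₀ = M_χ̃N_□` these are `M_χ̃(N_□∘Q)` and `∇_j(M_χ̃(N_□∘Q))` (associativity) — file 31's rows VERBATIM at `N := N_□∘Q`,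
fed by the RIGHT cut rows `M_χ(N_□∘Q) ≤ 1_S1_S·β^Qe^{−δd}`, `M_χ(∇^±_μN_□∘Q) ≤ 1_S1_S·β^Q₁e^{−δd}` (for dag-n15-a's cube: the transposed∕adjoint-divergence letters), common bound
`β̄^Q = β^Q + (β^Q₁ + c̃β^Q)`.

* ★★ `hasMaj_smoothCutDressed_comp_loc₂` (`X∘Q ≤ 1_S1_S·β̄^Q(1 − β̄Rc_r²)⁻¹e^{−ρ₂d}` for a nested-cut `Q`: `M_ψQM_{ψ₂} = M_ψQ`), ★★ `hasMaj_smoothCutDressed_comp_fgrad_loc₂` ∕ `…_bgrad_loc₂` (`Q = ∇^±_ν` with the one-step margin).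

HONEST FRAMING ∕ LIMITS.  Pure instantiation over DISPLAYED rows (left AND right cut rows of `N_□`, bump data, input cut-offs `ψ ⊂ ψ₂`, `V̂`'s letter); nothing of [B6]∕[B9] asserted ((2.133)
p.247, (3.42) p.397 (entry 2), (3.63)–(3.65) pp.402–403 = SHAPES ∕ MECHANISM).  NE2⁺ NOT PRINTED, NOT proved; N15 NOT discharged; counts of record UNMOVED (typed 28∕28 · discharged 5∕27); one finite
𝕋⁴ at fixed ε — NOT infinite volume, NOT OS on ℝ⁴, NOT a mass gap, NOT Clay; R4 closes the conditional finite-𝕋⁴ rung `BalabanLadder.UV` only.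
-/

set_option autoImplicit false

noncomputable section
open scoped BigOperators
open Finset

namespace Summit.QuantumFields.YangMills.BalabanUVNodes.N15.CurvedSpecies

open Literature.MathematicalPhysics.QuantumFieldTheory.Balaban1983to89
open Literature.MathematicalPhysics.QuantumFieldTheory.Balaban1983to89.B11SectG (BlockNorm HasMaj RowSum)
open Literature.MathematicalPhysics.QuantumFieldTheory.Balaban1983to89.B6RandomWalk (Triangle254)
open Literature.MathematicalPhysics.QuantumFieldTheory.Balaban1983to89.B6Prop26Gluing (mulOp mulOp_apply ind ind_nonneg)
open Summit.QuantumFields.YangMills.BalabanUVNodes.N15.MatrixSpecies (liftBlk liftEquiv liftEquiv_apply liftEquiv_symm_apply)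
open Summit.QuantumFields.YangMills.BalabanUVNodes.N15.BackgroundLayer (fgrad bgrad stack projO blkPair bgPropV projO_none_comp_stack)

variable {X ι J : Type} [Fintype X] [DecidableEq X] [Fintype ι] [DecidableEq ι] [Fintype J] [DecidableEq J] {g : B6.Geometry} (blk : X → g.Site) (τ : J → X ≃ X) (n : ℝ)
  {σ cr : ℝ} {N : (X × ι → ℝ) →ₗ[ℝ] (X × ι → ℝ)} {V : ((X × ι) × Option (J ⊕ J) → ℝ) →ₗ[ℝ] (X × ι → ℝ)} {χX χtX ψX ψ₂X : X → ℝ} {S : Set g.Site}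
  {β β₁ βQ βQ₁ ct δ : ℝ}

/-- ★★ **A RIGHT ENTRY OF THE DRESSED SMOOTH-CUT CUBE, TWO-SIDED**: coarse bump data and LEFT cut rows (`β, β₁`) as in file 34, the RIGHT cut rows of `N_□∘Q` (`β^Q`) and `∇^±_μN_□∘Q` (`β^Q₁`),
the nested input cut-offs `N = NM_ψ`, `M_ψQM_{ψ₂} = M_ψQ` (`supp ψ₂` over `S`), `V̂ ≤ Re^{−δ_Vd}`, `β̄Rc_r² < 1` ⟹ `X∘Q ≤ 1_S(y)1_S(y′)·β̄^Q(1 − β̄Rc_r²)⁻¹e^{−ρ₂d}`.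
[cite: Balaban1984PropagatorsII, (2.133) p.247 (shape); Balaban1985BackgroundPropagators, (3.42) p.397 (entry 2), (3.63)–(3.65) pp.402–403 (mechanism)] -/
theorem hasMaj_smoothCutDressed_comp_loc₂ (htri : Triangle254 g) (hd : ∀ a b : g.Site, 0 ≤ g.dist a b) (hrow : RowSum g σ cr) (hσ : 0 ≤ σ) {ρ₁ ρ₂ δV R : ℝ} (hβ : 0 ≤ β)
    (hβ₁ : 0 ≤ β₁) (hβQ : 0 ≤ βQ) (hβQ₁ : 0 ≤ βQ₁) (hct : 0 ≤ ct) (hR : 0 ≤ R) (hcr : 0 ≤ cr) (hσρ : σ ≤ ρ₁) (hρ₁V : ρ₁ ≤ δV) (hρ₁G : ρ₁ + σ ≤ δ) (hρ₂ : 0 ≤ ρ₂) (hρ₂₁ : ρ₂ + σ ≤ ρ₁)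
    (Q : (X × ι → ℝ) →ₗ[ℝ] (X × ι → ℝ)) (hSχ : ∀ x, χX x ≠ 0 → blk x ∈ S) (hSψ₂ : ∀ x, ψ₂X x ≠ 0 → blk x ∈ S) (hχt : ∀ x, |χtX x| ≤ 1)
    (hdχt : ∀ μ p, |fgrad n (liftEquiv (τ μ) ι) (fun p : X × ι => χtX p.1) p| ≤ ct) (hdχtb : ∀ μ p, |bgrad n (liftEquiv (τ μ) ι) (fun p : X × ι => χtX p.1) p| ≤ ct)
    (hsub : mulOp (fun p : X × ι => χtX p.1) ∘ₗ mulOp (fun p : X × ι => χX p.1) = mulOp (fun p : X × ι => χtX p.1))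
    (hχ : mulOp (fun p : X × ι => χX p.1) ∘ₗ mulOp (fun p : X × ι => χtX p.1) = mulOp (fun p : X × ι => χtX p.1))
    (hs : ∀ μ, mulOp ((fun p : X × ι => χtX p.1) ∘ (liftEquiv (τ μ) ι)) ∘ₗ mulOp (fun p : X × ι => χX p.1) = mulOp ((fun p : X × ι => χtX p.1) ∘ (liftEquiv (τ μ) ι)))
    (hsb : ∀ μ, mulOp ((fun p : X × ι => χtX p.1) ∘ (liftEquiv (τ μ) ι).symm) ∘ₗ mulOp (fun p : X × ι => χX p.1) = mulOp ((fun p : X × ι => χtX p.1) ∘ (liftEquiv (τ μ) ι).symm))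
    (hdd : ∀ μ, mulOp (fgrad n (liftEquiv (τ μ) ι) (fun p : X × ι => χtX p.1)) ∘ₗ mulOp (fun p : X × ι => χX p.1) = mulOp (fgrad n (liftEquiv (τ μ) ι) (fun p : X × ι => χtX p.1)))
    (hddb : ∀ μ, mulOp (bgrad n (liftEquiv (τ μ) ι) (fun p : X × ι => χtX p.1)) ∘ₗ mulOp (fun p : X × ι => χX p.1) = mulOp (bgrad n (liftEquiv (τ μ) ι) (fun p : X × ι => χtX p.1)))
    (hNψ : N ∘ₗ mulOp (fun p : X × ι => ψX p.1) = N)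
    (hQ : mulOp (fun p : X × ι => ψX p.1) ∘ₗ Q ∘ₗ mulOp (fun p : X × ι => ψ₂X p.1) = mulOp (fun p : X × ι => ψX p.1) ∘ₗ Q)
    (hcut : HasMaj (BlockNorm.ofBlocks g (liftBlk blk ι)) (BlockNorm.ofBlocks g (liftBlk blk ι)) (mulOp (fun p : X × ι => χX p.1) ∘ₗ N)
      (fun y y' => ind S y * ind S y' * (β * Real.exp (-(δ * g.dist y y')))))
    (hcutF : ∀ μ, HasMaj (BlockNorm.ofBlocks g (liftBlk blk ι)) (BlockNorm.ofBlocks g (liftBlk blk ι)) (mulOp (fun p : X × ι => χX p.1) ∘ₗ (fgrad n (liftEquiv (τ μ) ι) ∘ₗ N))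
      (fun y y' => ind S y * ind S y' * (β₁ * Real.exp (-(δ * g.dist y y')))))
    (hcutB : ∀ μ, HasMaj (BlockNorm.ofBlocks g (liftBlk blk ι)) (BlockNorm.ofBlocks g (liftBlk blk ι)) (mulOp (fun p : X × ι => χX p.1) ∘ₗ (bgrad n (liftEquiv (τ μ) ι) ∘ₗ N))
      (fun y y' => ind S y * ind S y' * (β₁ * Real.exp (-(δ * g.dist y y')))))
    (hcutQ : HasMaj (BlockNorm.ofBlocks g (liftBlk blk ι)) (BlockNorm.ofBlocks g (liftBlk blk ι)) (mulOp (fun p : X × ι => χX p.1) ∘ₗ (N ∘ₗ Q))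
      (fun y y' => ind S y * ind S y' * (βQ * Real.exp (-(δ * g.dist y y')))))
    (hcutFQ : ∀ μ, HasMaj (BlockNorm.ofBlocks g (liftBlk blk ι)) (BlockNorm.ofBlocks g (liftBlk blk ι)) (mulOp (fun p : X × ι => χX p.1) ∘ₗ (fgrad n (liftEquiv (τ μ) ι) ∘ₗ (N ∘ₗ Q)))
      (fun y y' => ind S y * ind S y' * (βQ₁ * Real.exp (-(δ * g.dist y y')))))
    (hcutBQ : ∀ μ, HasMaj (BlockNorm.ofBlocks g (liftBlk blk ι)) (BlockNorm.ofBlocks g (liftBlk blk ι)) (mulOp (fun p : X × ι => χX p.1) ∘ₗ (bgrad n (liftEquiv (τ μ) ι) ∘ₗ (N ∘ₗ Q)))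
      (fun y y' => ind S y * ind S y' * (βQ₁ * Real.exp (-(δ * g.dist y y')))))
    (hV : HasMaj (BlockNorm.ofBlocks g (blkPair (liftBlk blk ι))) (BlockNorm.ofBlocks g (liftBlk blk ι)) V (fun y y' => R * Real.exp (-(δV * g.dist y y'))))
    (hq : (β + (β₁ + ct * β)) * (R * cr) * cr < 1) :
    HasMaj (BlockNorm.ofBlocks g (liftBlk blk ι)) (BlockNorm.ofBlocks g (liftBlk blk ι))
      ((projO none ∘ₗ bgPropV (stack (mulOp (fun p : X × ι => χtX p.1) ∘ₗ N)
        (fun j => Sum.elim (fun μ => fgrad n (liftEquiv (τ μ) ι)) (fun μ => bgrad n (liftEquiv (τ μ) ι)) j ∘ₗ (mulOp (fun p : X × ι => χtX p.1) ∘ₗ N))) V) ∘ₗ Q)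
      (fun y y' => ind S y * ind S y' * ((βQ + (βQ₁ + ct * βQ)) * (1 - (β + (β₁ + ct * β)) * (R * cr) * cr)⁻¹ * Real.exp (-(ρ₂ * g.dist y y')))) := by
  have hβb : 0 ≤ β + (β₁ + ct * β) := by positivity
  have hβQb : 0 ≤ βQ + (βQ₁ + ct * βQ) := by positivity
  have hG := hasMaj_smoothCut_flat blk (S := S) hβ hβ₁ hct hχt hsub hcut
  have hD := hasMaj_jet_smoothCut_flat blk τ n (S := S) hβ hβ₁ hct hχt hdχt hdχtb hs hsb hdd hddb hcut hcutF hcutB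
  have hGQ : HasMaj (BlockNorm.ofBlocks g (liftBlk blk ι)) (BlockNorm.ofBlocks g (liftBlk blk ι)) ((mulOp (fun p : X × ι => χtX p.1) ∘ₗ N) ∘ₗ Q)
      (fun y y' => (βQ + (βQ₁ + ct * βQ)) * Real.exp (-(δ * g.dist y y'))) := by
    rw [LinearMap.comp_assoc]
    exact hasMaj_smoothCut_flat blk (S := S) hβQ hβQ₁ hct hχt hsub hcutQ
  have hDQ : ∀ j : J ⊕ J, HasMaj (BlockNorm.ofBlocks g (liftBlk blk ι)) (BlockNorm.ofBlocks g (liftBlk blk ι))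
      ((Sum.elim (fun μ => fgrad n (liftEquiv (τ μ) ι)) (fun μ => bgrad n (liftEquiv (τ μ) ι)) j ∘ₗ (mulOp (fun p : X × ι => χtX p.1) ∘ₗ N)) ∘ₗ Q)
      (fun y y' => (βQ + (βQ₁ + ct * βQ)) * Real.exp (-(δ * g.dist y y'))) := fun j => by
    rw [LinearMap.comp_assoc, LinearMap.comp_assoc]
    exact hasMaj_jet_smoothCut_flat blk τ n (S := S) hβQ hβQ₁ hct hχt hdχt hdχtb hs hsb hdd hddb hcutQ hcutFQ hcutBQ j
  have hχ0 : mulOp (fun p : X × ι => χX p.1) ∘ₗ (projO none ∘ₗ stack (mulOp (fun p : X × ι => χtX p.1) ∘ₗ N)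
      (fun j => Sum.elim (fun μ => fgrad n (liftEquiv (τ μ) ι)) (fun μ => bgrad n (liftEquiv (τ μ) ι)) j ∘ₗ (mulOp (fun p : X × ι => χtX p.1) ∘ₗ N))) =
      projO none ∘ₗ stack (mulOp (fun p : X × ι => χtX p.1) ∘ₗ N)
        (fun j => Sum.elim (fun μ => fgrad n (liftEquiv (τ μ) ι)) (fun μ => bgrad n (liftEquiv (τ μ) ι)) j ∘ₗ (mulOp (fun p : X × ι => χtX p.1) ∘ₗ N)) := by
    rw [projO_none_comp_stack]; exact smoothCut_out hχ
  exact hasMaj_projO_dressedV_comp_loc₂ blk htri hd hrow hσ hβb hβQb hR hcr hσρ hρ₁V hρ₁G hρ₂ hρ₂₁ (fun _ => rfl) none Q hSχ hSψ₂ hχ0 (smoothCut_in hNψ) hQ hG hD hGQ hDQ hV hq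

/-- ★★ **`X∘∇⁺_ν` FOR THE DRESSED SMOOTH-CUT CUBE, TWO-SIDED** (FILE 49 ∕ file 14 `hD` at a live background): ★★ above at `Q := ∇⁺_ν` with the one-step margin `ψ₂ = 1` on `supp ψ ∪ τ_ν(supp ψ)`.
[cite: Balaban1984PropagatorsII, (2.133)–(2.134) p.247 (shapes); Balaban1985BackgroundPropagators, (3.42) p.397, (3.65) p.403] -/
theorem hasMaj_smoothCutDressed_comp_fgrad_loc₂ (htri : Triangle254 g) (hd : ∀ a b : g.Site, 0 ≤ g.dist a b) (hrow : RowSum g σ cr) (hσ : 0 ≤ σ) {ρ₁ ρ₂ δV R : ℝ} (hβ : 0 ≤ β)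
    (hβ₁ : 0 ≤ β₁) (hβQ : 0 ≤ βQ) (hβQ₁ : 0 ≤ βQ₁) (hct : 0 ≤ ct) (hR : 0 ≤ R) (hcr : 0 ≤ cr) (hσρ : σ ≤ ρ₁) (hρ₁V : ρ₁ ≤ δV) (hρ₁G : ρ₁ + σ ≤ δ) (hρ₂ : 0 ≤ ρ₂) (hρ₂₁ : ρ₂ + σ ≤ ρ₁)
    (ν : J) (hSχ : ∀ x, χX x ≠ 0 → blk x ∈ S) (hSψ₂ : ∀ x, ψ₂X x ≠ 0 → blk x ∈ S) (hm : ∀ x, ψX x ≠ 0 → ψ₂X x = 1 ∧ ψ₂X (τ ν x) = 1) (hχt : ∀ x, |χtX x| ≤ 1)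
    (hdχt : ∀ μ p, |fgrad n (liftEquiv (τ μ) ι) (fun p : X × ι => χtX p.1) p| ≤ ct) (hdχtb : ∀ μ p, |bgrad n (liftEquiv (τ μ) ι) (fun p : X × ι => χtX p.1) p| ≤ ct)
    (hsub : mulOp (fun p : X × ι => χtX p.1) ∘ₗ mulOp (fun p : X × ι => χX p.1) = mulOp (fun p : X × ι => χtX p.1))
    (hχ : mulOp (fun p : X × ι => χX p.1) ∘ₗ mulOp (fun p : X × ι => χtX p.1) = mulOp (fun p : X × ι => χtX p.1))
    (hs : ∀ μ, mulOp ((fun p : X × ι => χtX p.1) ∘ (liftEquiv (τ μ) ι)) ∘ₗ mulOp (fun p : X × ι => χX p.1) = mulOp ((fun p : X × ι => χtX p.1) ∘ (liftEquiv (τ μ) ι)))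
    (hsb : ∀ μ, mulOp ((fun p : X × ι => χtX p.1) ∘ (liftEquiv (τ μ) ι).symm) ∘ₗ mulOp (fun p : X × ι => χX p.1) = mulOp ((fun p : X × ι => χtX p.1) ∘ (liftEquiv (τ μ) ι).symm))
    (hdd : ∀ μ, mulOp (fgrad n (liftEquiv (τ μ) ι) (fun p : X × ι => χtX p.1)) ∘ₗ mulOp (fun p : X × ι => χX p.1) = mulOp (fgrad n (liftEquiv (τ μ) ι) (fun p : X × ι => χtX p.1)))
    (hddb : ∀ μ, mulOp (bgrad n (liftEquiv (τ μ) ι) (fun p : X × ι => χtX p.1)) ∘ₗ mulOp (fun p : X × ι => χX p.1) = mulOp (bgrad n (liftEquiv (τ μ) ι) (fun p : X × ι => χtX p.1)))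
    (hNψ : N ∘ₗ mulOp (fun p : X × ι => ψX p.1) = N)
    (hcut : HasMaj (BlockNorm.ofBlocks g (liftBlk blk ι)) (BlockNorm.ofBlocks g (liftBlk blk ι)) (mulOp (fun p : X × ι => χX p.1) ∘ₗ N)
      (fun y y' => ind S y * ind S y' * (β * Real.exp (-(δ * g.dist y y')))))
    (hcutF : ∀ μ, HasMaj (BlockNorm.ofBlocks g (liftBlk blk ι)) (BlockNorm.ofBlocks g (liftBlk blk ι)) (mulOp (fun p : X × ι => χX p.1) ∘ₗ (fgrad n (liftEquiv (τ μ) ι) ∘ₗ N))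
      (fun y y' => ind S y * ind S y' * (β₁ * Real.exp (-(δ * g.dist y y')))))
    (hcutB : ∀ μ, HasMaj (BlockNorm.ofBlocks g (liftBlk blk ι)) (BlockNorm.ofBlocks g (liftBlk blk ι)) (mulOp (fun p : X × ι => χX p.1) ∘ₗ (bgrad n (liftEquiv (τ μ) ι) ∘ₗ N))
      (fun y y' => ind S y * ind S y' * (β₁ * Real.exp (-(δ * g.dist y y')))))
    (hcutQ : HasMaj (BlockNorm.ofBlocks g (liftBlk blk ι)) (BlockNorm.ofBlocks g (liftBlk blk ι)) (mulOp (fun p : X × ι => χX p.1) ∘ₗ (N ∘ₗ fgrad n (liftEquiv (τ ν) ι)))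
      (fun y y' => ind S y * ind S y' * (βQ * Real.exp (-(δ * g.dist y y')))))
    (hcutFQ : ∀ μ, HasMaj (BlockNorm.ofBlocks g (liftBlk blk ι)) (BlockNorm.ofBlocks g (liftBlk blk ι))
      (mulOp (fun p : X × ι => χX p.1) ∘ₗ (fgrad n (liftEquiv (τ μ) ι) ∘ₗ (N ∘ₗ fgrad n (liftEquiv (τ ν) ι)))) (fun y y' => ind S y * ind S y' * (βQ₁ * Real.exp (-(δ * g.dist y y')))))
    (hcutBQ : ∀ μ, HasMaj (BlockNorm.ofBlocks g (liftBlk blk ι)) (BlockNorm.ofBlocks g (liftBlk blk ι))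
      (mulOp (fun p : X × ι => χX p.1) ∘ₗ (bgrad n (liftEquiv (τ μ) ι) ∘ₗ (N ∘ₗ fgrad n (liftEquiv (τ ν) ι)))) (fun y y' => ind S y * ind S y' * (βQ₁ * Real.exp (-(δ * g.dist y y')))))
    (hV : HasMaj (BlockNorm.ofBlocks g (blkPair (liftBlk blk ι))) (BlockNorm.ofBlocks g (liftBlk blk ι)) V (fun y y' => R * Real.exp (-(δV * g.dist y y'))))
    (hq : (β + (β₁ + ct * β)) * (R * cr) * cr < 1) :
    HasMaj (BlockNorm.ofBlocks g (liftBlk blk ι)) (BlockNorm.ofBlocks g (liftBlk blk ι))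
      ((projO none ∘ₗ bgPropV (stack (mulOp (fun p : X × ι => χtX p.1) ∘ₗ N)
        (fun j => Sum.elim (fun μ => fgrad n (liftEquiv (τ μ) ι)) (fun μ => bgrad n (liftEquiv (τ μ) ι)) j ∘ₗ (mulOp (fun p : X × ι => χtX p.1) ∘ₗ N))) V) ∘ₗ fgrad n (liftEquiv (τ ν) ι))
      (fun y y' => ind S y * ind S y' * ((βQ + (βQ₁ + ct * βQ)) * (1 - (β + (β₁ + ct * β)) * (R * cr) * cr)⁻¹ * Real.exp (-(ρ₂ * g.dist y y')))) :=
  hasMaj_smoothCutDressed_comp_loc₂ blk τ n htri hd hrow hσ hβ hβ₁ hβQ hβQ₁ hct hR hcr hσρ hρ₁V hρ₁G hρ₂ hρ₂₁ _ hSχ hSψ₂ hχt hdχt hdχtb hsub hχ hs hsb hdd hddb hNψ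
    (mulOp_comp_fgrad_comp_mulOp_of_margin n (τ ν) hm) hcut hcutF hcutB hcutQ hcutFQ hcutBQ hV hq

/-- ★★ **`X∘∇⁻_ν` FOR THE DRESSED SMOOTH-CUT CUBE, TWO-SIDED** (`hDb`), margin `ψ₂ = 1` on `supp ψ ∪ τ_ν⁻¹(supp ψ)`. [cite: Balaban1984PropagatorsII, (2.133)–(2.134) p.247 (shapes); Balaban1985BackgroundPropagators, (3.42) p.397, (3.65) p.403] -/
theorem hasMaj_smoothCutDressed_comp_bgrad_loc₂ (htri : Triangle254 g) (hd : ∀ a b : g.Site, 0 ≤ g.dist a b) (hrow : RowSum g σ cr) (hσ : 0 ≤ σ) {ρ₁ ρ₂ δV R : ℝ} (hβ : 0 ≤ β)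
    (hβ₁ : 0 ≤ β₁) (hβQ : 0 ≤ βQ) (hβQ₁ : 0 ≤ βQ₁) (hct : 0 ≤ ct) (hR : 0 ≤ R) (hcr : 0 ≤ cr) (hσρ : σ ≤ ρ₁) (hρ₁V : ρ₁ ≤ δV) (hρ₁G : ρ₁ + σ ≤ δ) (hρ₂ : 0 ≤ ρ₂) (hρ₂₁ : ρ₂ + σ ≤ ρ₁)
    (ν : J) (hSχ : ∀ x, χX x ≠ 0 → blk x ∈ S) (hSψ₂ : ∀ x, ψ₂X x ≠ 0 → blk x ∈ S) (hm : ∀ x, ψX x ≠ 0 → ψ₂X x = 1 ∧ ψ₂X ((τ ν).symm x) = 1) (hχt : ∀ x, |χtX x| ≤ 1)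
    (hdχt : ∀ μ p, |fgrad n (liftEquiv (τ μ) ι) (fun p : X × ι => χtX p.1) p| ≤ ct) (hdχtb : ∀ μ p, |bgrad n (liftEquiv (τ μ) ι) (fun p : X × ι => χtX p.1) p| ≤ ct)
    (hsub : mulOp (fun p : X × ι => χtX p.1) ∘ₗ mulOp (fun p : X × ι => χX p.1) = mulOp (fun p : X × ι => χtX p.1))
    (hχ : mulOp (fun p : X × ι => χX p.1) ∘ₗ mulOp (fun p : X × ι => χtX p.1) = mulOp (fun p : X × ι => χtX p.1))
    (hs : ∀ μ, mulOp ((fun p : X × ι => χtX p.1) ∘ (liftEquiv (τ μ) ι)) ∘ₗ mulOp (fun p : X × ι => χX p.1) = mulOp ((fun p : X × ι => χtX p.1) ∘ (liftEquiv (τ μ) ι)))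
    (hsb : ∀ μ, mulOp ((fun p : X × ι => χtX p.1) ∘ (liftEquiv (τ μ) ι).symm) ∘ₗ mulOp (fun p : X × ι => χX p.1) = mulOp ((fun p : X × ι => χtX p.1) ∘ (liftEquiv (τ μ) ι).symm))
    (hdd : ∀ μ, mulOp (fgrad n (liftEquiv (τ μ) ι) (fun p : X × ι => χtX p.1)) ∘ₗ mulOp (fun p : X × ι => χX p.1) = mulOp (fgrad n (liftEquiv (τ μ) ι) (fun p : X × ι => χtX p.1)))
    (hddb : ∀ μ, mulOp (bgrad n (liftEquiv (τ μ) ι) (fun p : X × ι => χtX p.1)) ∘ₗ mulOp (fun p : X × ι => χX p.1) = mulOp (bgrad n (liftEquiv (τ μ) ι) (fun p : X × ι => χtX p.1)))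
    (hNψ : N ∘ₗ mulOp (fun p : X × ι => ψX p.1) = N)
    (hcut : HasMaj (BlockNorm.ofBlocks g (liftBlk blk ι)) (BlockNorm.ofBlocks g (liftBlk blk ι)) (mulOp (fun p : X × ι => χX p.1) ∘ₗ N)
      (fun y y' => ind S y * ind S y' * (β * Real.exp (-(δ * g.dist y y')))))
    (hcutF : ∀ μ, HasMaj (BlockNorm.ofBlocks g (liftBlk blk ι)) (BlockNorm.ofBlocks g (liftBlk blk ι)) (mulOp (fun p : X × ι => χX p.1) ∘ₗ (fgrad n (liftEquiv (τ μ) ι) ∘ₗ N))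
      (fun y y' => ind S y * ind S y' * (β₁ * Real.exp (-(δ * g.dist y y')))))
    (hcutB : ∀ μ, HasMaj (BlockNorm.ofBlocks g (liftBlk blk ι)) (BlockNorm.ofBlocks g (liftBlk blk ι)) (mulOp (fun p : X × ι => χX p.1) ∘ₗ (bgrad n (liftEquiv (τ μ) ι) ∘ₗ N))
      (fun y y' => ind S y * ind S y' * (β₁ * Real.exp (-(δ * g.dist y y')))))
    (hcutQ : HasMaj (BlockNorm.ofBlocks g (liftBlk blk ι)) (BlockNorm.ofBlocks g (liftBlk blk ι)) (mulOp (fun p : X × ι => χX p.1) ∘ₗ (N ∘ₗ bgrad n (liftEquiv (τ ν) ι)))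
      (fun y y' => ind S y * ind S y' * (βQ * Real.exp (-(δ * g.dist y y')))))
    (hcutFQ : ∀ μ, HasMaj (BlockNorm.ofBlocks g (liftBlk blk ι)) (BlockNorm.ofBlocks g (liftBlk blk ι))
      (mulOp (fun p : X × ι => χX p.1) ∘ₗ (fgrad n (liftEquiv (τ μ) ι) ∘ₗ (N ∘ₗ bgrad n (liftEquiv (τ ν) ι)))) (fun y y' => ind S y * ind S y' * (βQ₁ * Real.exp (-(δ * g.dist y y')))))
    (hcutBQ : ∀ μ, HasMaj (BlockNorm.ofBlocks g (liftBlk blk ι)) (BlockNorm.ofBlocks g (liftBlk blk ι))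
      (mulOp (fun p : X × ι => χX p.1) ∘ₗ (bgrad n (liftEquiv (τ μ) ι) ∘ₗ (N ∘ₗ bgrad n (liftEquiv (τ ν) ι)))) (fun y y' => ind S y * ind S y' * (βQ₁ * Real.exp (-(δ * g.dist y y')))))
    (hV : HasMaj (BlockNorm.ofBlocks g (blkPair (liftBlk blk ι))) (BlockNorm.ofBlocks g (liftBlk blk ι)) V (fun y y' => R * Real.exp (-(δV * g.dist y y'))))
    (hq : (β + (β₁ + ct * β)) * (R * cr) * cr < 1) :
    HasMaj (BlockNorm.ofBlocks g (liftBlk blk ι)) (BlockNorm.ofBlocks g (liftBlk blk ι))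
      ((projO none ∘ₗ bgPropV (stack (mulOp (fun p : X × ι => χtX p.1) ∘ₗ N)
        (fun j => Sum.elim (fun μ => fgrad n (liftEquiv (τ μ) ι)) (fun μ => bgrad n (liftEquiv (τ μ) ι)) j ∘ₗ (mulOp (fun p : X × ι => χtX p.1) ∘ₗ N))) V) ∘ₗ bgrad n (liftEquiv (τ ν) ι))
      (fun y y' => ind S y * ind S y' * ((βQ + (βQ₁ + ct * βQ)) * (1 - (β + (β₁ + ct * β)) * (R * cr) * cr)⁻¹ * Real.exp (-(ρ₂ * g.dist y y')))) :=
  hasMaj_smoothCutDressed_comp_loc₂ blk τ n htri hd hrow hσ hβ hβ₁ hβQ hβQ₁ hct hR hcr hσρ hρ₁V hρ₁G hρ₂ hρ₂₁ _ hSχ hSψ₂ hχt hdχt hdχtb hsub hχ hs hsb hdd hddb hNψ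
    (mulOp_comp_bgrad_comp_mulOp_of_margin n (τ ν) hm) hcut hcutF hcutB hcutQ hcutFQ hcutBQ hV hq

end Summit.QuantumFields.YangMills.BalabanUVNodes.N15.CurvedSpecies

end
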